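import Mathlib
import HarnessLib
import Summits.HubbardSuperconductivity.HubbardSuperconductivity.Theorems.KLProgrammeKLRegimeKernelNormsLevelsDefs

/-!
# Route `KLProgramme` — gen-6 ENGINE child `KLRegimeEngineV15`, private invariant (E1-F) `KernelNormsLevels` at SCALE 0
# (cell gate-hubbard-kl, seat p1 g9 = engine-skeleton registrant; (R12) T3 v2 door)

At scale `n = 0` the sector-level gain factor of `KernelNormsLevels` (p504160) is `((2^0)⁻¹)^e = 1`, and a prescription of legs only drops
tuples (`klAnisoLegKernelNormAt_le`), so the level-refined norms at scale `0` FOLLOW from the plain scale-`0` kernel norms (E1-v4)₀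
`KernelNormsV4 … 0` — the base of the composition's induction over the public history needs no extra stub:
`kernelNormsLevels_zero_of_kernelNormsV4` (+ Wick twin).  Proved; no definitions.
-/

noncomputable section

namespace Summit.HubbardSuperconductivity.HubbardSuperconductivity.Theorems.KLRegimeSplit

set_option linter.dupNamespace false -- summit = problem name (single-conjunct summit), D-0017

open Real Finset Literature.MathematicalPhysics.QuantumLattice Literature.Probability.LatticeModels
open Summit.HubbardSuperconductivity.HubbardSuperconductivity.Theorems.KLProgrammeLegKernels

section Model

variable {L M : ℕ} [NeZero L]

/-- **(E1-F) at scale `0` from (E1-v4)₀**: `KernelNormsV4 … 0 → KernelNormsLevels … 0` (the gain factor is `1` at `n = 0`). -/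
theorem kernelNormsLevels_zero_of_kernelNormsV4 {P : SplitConsts} {Q : EngConsts} {β U μ : ℝ} (hβ : 0 ≤ β) {K : TrigPolyC4v}
    (hE1 : KernelNormsV4 L M P Q β U μ K 0) : KernelNormsLevels L M P Q β U μ K 0 := by
  intro p hp Ωe
  rw [pow_zero, inv_one, one_pow, mul_one]
  exact (klAnisoLegKernelNormAt_le hβ U μ K klE0 0 (2 * p) Ωe).trans (hE1 p (by omega))

/-- The Wick twin: `KernelNormsW … 0 → KernelNormsLevelsW … 0`. -/
theorem kernelNormsLevelsW_zero_of_kernelNormsW {P : SplitConsts} {Q : EngConsts} {β U μ : ℝ} (hβ : 0 ≤ β) {K : TrigPolyC4v}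
    (hE1 : KernelNormsW L M P Q β U μ K 0) : KernelNormsLevelsW L M P Q β U μ K 0 := by
  intro p hp Ωe
  rw [pow_zero, inv_one, one_pow, mul_one]
  exact (klWickAnisoLegKernelNormAt_le hβ U μ K 0 (2 * p) Ωe).trans (hE1 p (by omega))

end Model

end Summit.HubbardSuperconductivity.HubbardSuperconductivity.Theorems.KLRegimeSplit

end
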